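import Summits.ResolutionOfSingularities.ResolutionOfSingularities.Theorems.HilbertSamuelEliminationSigmaMaxModificationsCorridor3WLadderIsoTailsTowerBaseChangeGeomReduced
import HarnessLib

/-!
# [OURS · L1 W4.2] K2-sep ROUTE A, brick (δ3) — DEFINITION FILE: **the base change `T ×_{X_0} S₀` of a tower of blow-ups along a FLAT
# GEOMETRICALLY REDUCED `ι₀ : S₀ → X_0`, as a `BlowupTower`** (res-type-053's `BlowupTower.baseChange`, `Literature/…/BlowupTowerLocalize`,
# with its flat-PREIMMERSION hypothesis replaced by flat + geometrically reduced — the case `ι₀ = X_0 ×_k K → X_0` of a separable ground-field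
# extension; stages and maps are 053's `bcX / bcι / bcπ`, the `isBlowup` field is `isBlowup_bcπ_vanishingIdeal_preimage`)
# (crux `SigmaMaxModifications` stmt-ResolutionOfSingularities-18506 / conjunct stmt-…-19249; line `w_ladder_rows` v8.5, registered stub
# `stub_isoSepRecurrent`; res-L1-w42-plan-1 WORD 2026-08-27T16:25:47Z; design `L/res-L1-w42-stub-2/k2sep/K2SEP-DESIGN.md` §8 (δ3))

Prover res-L1-w42-stub-2 (gen 5). DEFINITION file (one `abbrev`, reviewed lane), `--supports stmt-ResolutionOfSingularities-19249 --as helper`. OURS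
(cell res-hironaka, slot W4.2); an object the K2-sep reduction posits (the base-changed tower the assembly (ε) runs K1-à-la-carte on); NOT a statement of
[Hironaka2017] nor of [CossartJannsenSaito2020] (whose p. 107 / GW 13.91 (2) it packages). AI-written; AI review is weaker than expert review.

* **`BlowupTower.baseChangeGR T ι₀`** — the tower `S_0 = S₀`, `S_{n+1} = X_{n+1} ×_{X_n} S_n`, centres `ι_n⁻¹(C_n)`, blow-ups `pr₂`, for `ι₀` flat,
  geometrically reduced, `S₀` locally noetherian.
* `baseChangeGR_X` / `baseChangeGR_C` / `baseChangeGR_π` — `rfl` lemmas.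

[OURS · L1 W4.2; AI-written] [cite: CossartJannsenSaito2020, p. 107] [cite: GortzWedhorn2020, Prop. 13.91 (2)]
-/

set_option linter.dupNamespace false

noncomputable section

open CategoryTheory CategoryTheory.Limits AlgebraicGeometry TopologicalSpace
open Literature.AlgebraicGeometry.Resolution Literature.AlgebraicGeometry.CossartJannsenSaito2020

namespace Summit.ResolutionOfSingularities.ResolutionOfSingularities.Theorems.SigmaMaxModificationsCorridor3.IsoTailsHS

universe u

namespace BlowupTower

variable (T : BlowupTower.{u}) {S₀ : Scheme.{u}} (ι₀ : S₀ ⟶ T.X 0) [Flat ι₀] [GeometricallyReduced ι₀] [IsLocallyNoetherian S₀]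

/-- **The base change `T ×_{X_0} S₀` of a tower of blow-ups along a flat geometrically reduced `ι₀ : S₀ ⟶ X_0`** (e.g. the projection
`X_0 ×_k K → X_0` of a separable ground-field extension): stages `S_{n+1} = X_{n+1} ×_{X_n} S_n` (res-type-053's `bcX`), centres `ι_n⁻¹(C_n)`, and
`S_{n+1} → S_n` IS the blow-up of `S_n` in `ι_n⁻¹(C_n)` with its REDUCED structure (`isBlowup_bcπ_vanishingIdeal_preimage`). Verbatim 053's
`BlowupTower.baseChange` with `IsPreimmersion ι₀` replaced by `GeometricallyReduced ι₀`.
[cite: CossartJannsenSaito2020, p. 107] [cite: GortzWedhorn2020, Prop. 13.91 (2)] -/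
abbrev baseChangeGR : BlowupTower.{u} where
  X n := T.bcX ι₀ n
  ln n := T.isLocallyNoetherian_bcX ι₀ n
  C n := (T.bcι ι₀ n).base ⁻¹' T.C n
  isClosed_C n := by haveI := T.ln n; exact (T.isClosed_C n).preimage (T.bcι ι₀ n).continuous
  π n := T.bcπ ι₀ n
  isBlowup n := isBlowup_bcπ_vanishingIdeal_preimage T ι₀ n

/-- The stages of the base-changed tower are 053's `S_n = T.bcX ι₀ n`. [cite: CossartJannsenSaito2020, p. 107] -/
@[simp] theorem baseChangeGR_X (n : ℕ) : (baseChangeGR T ι₀).X n = T.bcX ι₀ n := rfl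

/-- The centres of the base-changed tower are the preimages `ι_n⁻¹(C_n)`. [cite: CossartJannsenSaito2020, p. 107] -/
@[simp] theorem baseChangeGR_C (n : ℕ) : (baseChangeGR T ι₀).C n = (T.bcι ι₀ n).base ⁻¹' T.C n := rfl

/-- The blow-ups of the base-changed tower are 053's `π'_n = T.bcπ ι₀ n`. [cite: CossartJannsenSaito2020, p. 107] -/
@[simp] theorem baseChangeGR_π (n : ℕ) : (baseChangeGR T ι₀).π n = T.bcπ ι₀ n := rfl

end BlowupTower

end Summit.ResolutionOfSingularities.ResolutionOfSingularities.Theorems.SigmaMaxModificationsCorridor3.IsoTailsHS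

end
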